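import Summits.Ventures.PercRepro.S1ChainSkewClosure

/-!
# PercRepro — THE PRINCIPAL CLOSED TRACE OF AN OUTSIDE POINT (p2, gen 24; SUBCLAIM-S1 §6.9 (vii) step 3)

For a point `z` in the closure of a skew union `U` of triangles, the closed traces `A ⊆ U` whose closure contains
`z` are closed under intersection (S1ChainSkewClosure), so one of minimal size is contained in all of them: the
PRINCIPAL closed trace `F_z` — `z ∈ cl A ⇔ F_z ⊆ A` for closed traces `A`. The circuits through `z` with their other
points in `U` are the minimal sets whose hull contains `F_z`; their count by size is read off the shape of `F_z`
(a point or the whole triangle on each coordinate) — the one-point counts of the joint cap of row 10.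

* **`exists_principal_closedTrace`** — the principal closed trace.
Axioms: standard.
-/

open scoped Matroid

namespace PercRepro

namespace S1

open Set

variable {α : Type}

/-- **THE PRINCIPAL FILTER OF AN OUTSIDE POINT**: for `z ∈ E` in the closure of a skew union `U`, there is a closed
trace `F ⊆ U` with `z ∈ cl F` contained in EVERY closed trace whose closure contains `z` (a closed trace of minimal
size among them; the filter property shrinks any competitor to it). -/
theorem exists_principal_closedTrace (M : Matroid α) [M.Finite] (𝒯 : Finset (Set α))
    (h𝒯 : ∀ C ∈ 𝒯, M.IsCircuit C ∧ C.ncard = 3) (hskew : M.eRk (⋃ C ∈ 𝒯, C) = 2 * 𝒯.card)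
    {z : α} (hz : z ∈ M.E) (hzU : z ∈ M.closure (⋃ C ∈ 𝒯, C)) :
    ∃ F ⊆ ⋃ C ∈ 𝒯, C, (∀ T ∈ 𝒯, (F ∩ T).ncard ≤ 1 ∨ T ⊆ F) ∧ z ∈ M.closure F ∧
      ∀ A ⊆ ⋃ C ∈ 𝒯, C, (∀ T ∈ 𝒯, (A ∩ T).ncard ≤ 1 ∨ T ⊆ A) → z ∈ M.closure A → F ⊆ A := by
  classical
  have hUE := biUnion_subset_ground M 𝒯 h𝒯
  have hUfin : (⋃ C ∈ 𝒯, C).Finite := M.ground_finite.subset hUE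
  set 𝓕 : Set (Set α) := {A | A ⊆ (⋃ C ∈ 𝒯, C) ∧ (∀ T ∈ 𝒯, (A ∩ T).ncard ≤ 1 ∨ T ⊆ A) ∧ z ∈ M.closure A}
    with h𝓕
  have h𝓕fin : 𝓕.Finite := hUfin.finite_subsets.subset (fun A hA => hA.1)
  have hU𝓕 : (⋃ C ∈ 𝒯, C) ∈ 𝓕 := by
    refine ⟨Set.Subset.rfl, fun T hT => Or.inr (fun x hx => Set.mem_iUnion₂.2 ⟨T, hT, hx⟩), hzU⟩
  obtain ⟨F, hF, hmin⟩ := Set.exists_min_image 𝓕 Set.ncard h𝓕fin ⟨_, hU𝓕⟩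
  obtain ⟨hFU, hFcl, hzF⟩ := hF
  refine ⟨F, hFU, hFcl, hzF, fun A hAU hAcl hzA => ?_⟩
  have hFA : F ∩ A ∈ 𝓕 :=
    ⟨Set.inter_subset_left.trans hFU, closedTrace_inter M 𝒯 h𝒯 hFcl hAcl,
      mem_closure_inter_of_closedTrace M 𝒯 h𝒯 hskew hFU hFcl hAU hAcl hz hzF hzA⟩
  have hle := hmin (F ∩ A) hFA
  have heq : F ∩ A = F :=
    Set.eq_of_subset_of_ncard_le Set.inter_subset_left hle (hUfin.subset hFU)
  rw [← heq]
  exact Set.inter_subset_right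

end S1

end PercRepro
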